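import Mathlib.AlgebraicGeometry.Properties
import Mathlib.Topology.Sheaves.CommRingCat
import HarnessLib

/-!
# Idempotent sections on a connected reduced scheme; gluing over two opens

Topic: `Literature/AlgebraicGeometry/FundamentalGroup`. Two elementary facts used to feed
connectedness of a cover `Y → ℙ¹` into the lattice criterion of `ProjectiveLineLattices.lean`:

* `eq_zero_or_eq_one_of_isIdempotentElem` — on a connected reduced scheme an idempotent global
  function `e` is `0` or `1` (`X = D(e) ⊔ D(1 - e)` disjointly, so `D(e)` is clopen; reducedness
  turns `D(e) = ∅` into `e = 0`, Mathlib `basicOpen_eq_bot_iff`);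
* `exists_glue_two`, `restrict_eq_zero_or_one_of_isIdempotentElem` — sections over `U`, `V`
  agreeing on `U ∩ V` glue (Mathlib `TopCat.Sheaf.objSupIsoProdEqLocus`), hence idempotents on
  two charts covering a connected reduced scheme which agree on the overlap restrict to `0` or
  `1` there.

No definitions, no named facts. [folklore]
-/

noncomputable section

open CategoryTheory AlgebraicGeometry TopologicalSpace Opposite

namespace Literature.AlgebraicGeometry.FundamentalGroup

universe u

/-! ### Idempotent sections on a connected reduced scheme -/

/-- On a connected reduced scheme an idempotent global function is `0` or `1`: `X = D(e) ⊔ D(1-e)`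
disjointly, so `D(e)` is clopen. [folklore] -/
theorem eq_zero_or_eq_one_of_isIdempotentElem {X : Scheme.{u}} [IsReduced X] [PreconnectedSpace X]
    (e : Γ(X, ⊤)) (he : IsIdempotentElem e) : e = 0 ∨ e = 1 := by
  have hinf : X.basicOpen e ⊓ X.basicOpen (1 - e) = ⊥ := by
    rw [← Scheme.basicOpen_mul, he.mul_one_sub_self, Scheme.basicOpen_zero]
  have hsup : X.basicOpen e ⊔ X.basicOpen (1 - e) = ⊤ := by
    rw [eq_top_iff]
    rintro x -
    have h1 : X.presheaf.germ ⊤ x trivial e + X.presheaf.germ ⊤ x trivial (1 - e) = 1 := by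
      rw [← map_add, add_sub_cancel, map_one]
    rcases IsLocalRing.isUnit_or_isUnit_of_isUnit_add (h1 ▸ isUnit_one) with h | h
    · exact Opens.mem_sup.mpr (Or.inl ((Scheme.mem_basicOpen_top X e x).mpr h))
    · exact Opens.mem_sup.mpr (Or.inr ((Scheme.mem_basicOpen_top X (1 - e) x).mpr h))
  have hclopen : IsClopen (X.basicOpen e : Set X) := by
    refine ⟨⟨?_⟩, (X.basicOpen e).isOpen⟩
    have : (X.basicOpen e : Set X)ᶜ = (X.basicOpen (1 - e) : Set X) := by
      apply Set.Subset.antisymm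
      · intro x hx
        have : x ∈ (X.basicOpen e ⊔ X.basicOpen (1 - e) : X.Opens) := by
          rw [hsup]; trivial
        rcases Opens.mem_sup.mp this with h | h
        · exact absurd h hx
        · exact h
      · intro x hx hx'
        have : x ∈ (X.basicOpen e ⊓ X.basicOpen (1 - e) : X.Opens) := ⟨hx', hx⟩
        rw [hinf] at this
        exact this
    rw [this]
    exact (X.basicOpen (1 - e)).isOpen
  rcases isClopen_iff.mp hclopen with h | h
  · left
    exact (basicOpen_eq_bot_iff e).mp (Opens.ext h)
  · right
    have hbot : X.basicOpen (1 - e) = ⊥ := by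
      have htop : X.basicOpen e = ⊤ := Opens.ext h
      rw [htop, top_inf_eq] at hinf
      exact hinf
    have := (basicOpen_eq_bot_iff (1 - e)).mp hbot
    exact (sub_eq_zero.mp this).symm

/-- An idempotent section over an open `U ⊔ V = X` of a connected reduced scheme is `0` or `1`.
[folklore] -/
theorem eq_zero_or_eq_one_of_isIdempotentElem_of_eq_top {X : Scheme.{u}} [IsReduced X]
    [PreconnectedSpace X] {W : X.Opens} (hW : W = ⊤) (e : Γ(X, W)) (he : IsIdempotentElem e) :
    e = 0 ∨ e = 1 := by
  subst hW
  exact eq_zero_or_eq_one_of_isIdempotentElem e he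

/-! ### Gluing two sections -/

/-- **Gluing over two opens**: sections over `U` and `V` agreeing on `U ∩ V` come from a section
over `U ∪ V` (the sheaf condition, Mathlib `TopCat.Sheaf.objSupIsoProdEqLocus`). [folklore] -/
theorem exists_glue_two {X : Scheme.{u}} (U V : X.Opens) (s : Γ(X, U)) (t : Γ(X, V))
    (h : X.presheaf.map (homOfLE inf_le_left : U ⊓ V ⟶ U).op s =
      X.presheaf.map (homOfLE inf_le_right : U ⊓ V ⟶ V).op t) :
    ∃ g : Γ(X, U ⊔ V), X.presheaf.map (homOfLE le_sup_left : U ⟶ U ⊔ V).op g = s ∧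
      X.presheaf.map (homOfLE le_sup_right : V ⟶ U ⊔ V).op g = t := by
  refine ⟨(X.sheaf.objSupIsoProdEqLocus U V).inv ⟨(s, t), h⟩, ?_, ?_⟩
  · exact X.sheaf.objSupIsoProdEqLocus_inv_fst U V ⟨(s, t), h⟩
  · exact X.sheaf.objSupIsoProdEqLocus_inv_snd U V ⟨(s, t), h⟩

/-- **Idempotents glued from two charts are trivial**: on a connected reduced scheme covered by
`U` and `V`, if idempotents `e₀` over `U` and `e₁` over `V` agree on `U ∩ V`, their common
restriction is `0` or `1`. [folklore] -/
theorem restrict_eq_zero_or_one_of_isIdempotentElem {X : Scheme.{u}} [IsReduced X]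
    [PreconnectedSpace X] {U V : X.Opens} (hUV : U ⊔ V = ⊤) (e₀ : Γ(X, U)) (e₁ : Γ(X, V))
    (he₀ : IsIdempotentElem e₀) (he₁ : IsIdempotentElem e₁)
    (h : X.presheaf.map (homOfLE inf_le_left : U ⊓ V ⟶ U).op e₀ =
      X.presheaf.map (homOfLE inf_le_right : U ⊓ V ⟶ V).op e₁) :
    X.presheaf.map (homOfLE inf_le_left : U ⊓ V ⟶ U).op e₀ = 0 ∨
      X.presheaf.map (homOfLE inf_le_left : U ⊓ V ⟶ U).op e₀ = 1 := by
  obtain ⟨g, hg₀, hg₁⟩ := exists_glue_two U V e₀ e₁ h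
  have hg : IsIdempotentElem g := by
    -- `g * g` and `g` have the same restrictions to `U` and `V`
    apply (X.sheaf.objSupIsoProdEqLocus U V).commRingCatIsoToRingEquiv.injective
    apply Subtype.ext
    apply Prod.ext
    · change ((X.sheaf.objSupIsoProdEqLocus U V).hom (g * g)).1.1 =
        ((X.sheaf.objSupIsoProdEqLocus U V).hom g).1.1
      rw [X.sheaf.objSupIsoProdEqLocus_hom_fst, X.sheaf.objSupIsoProdEqLocus_hom_fst]
      change (X.presheaf.map (homOfLE le_sup_left : U ⟶ U ⊔ V).op).hom (g * g) =
        (X.presheaf.map (homOfLE le_sup_left : U ⟶ U ⊔ V).op).hom g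
      rw [map_mul, hg₀, he₀.eq]
    · change ((X.sheaf.objSupIsoProdEqLocus U V).hom (g * g)).1.2 =
        ((X.sheaf.objSupIsoProdEqLocus U V).hom g).1.2
      rw [X.sheaf.objSupIsoProdEqLocus_hom_snd, X.sheaf.objSupIsoProdEqLocus_hom_snd]
      change (X.presheaf.map (homOfLE le_sup_right : V ⟶ U ⊔ V).op).hom (g * g) =
        (X.presheaf.map (homOfLE le_sup_right : V ⟶ U ⊔ V).op).hom g
      rw [map_mul, hg₁, he₁.eq]
  rcases eq_zero_or_eq_one_of_isIdempotentElem_of_eq_top hUV g hg with hg' | hg'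
  · left
    rw [← hg₀, hg', map_zero, map_zero]
  · right
    rw [← hg₀, hg', map_one, map_one]

end Literature.AlgebraicGeometry.FundamentalGroup
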